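import Literature.AnabelianGeometry.AbsoluteAnabelian.AbsTopII.EllipticCuspidalizationCanonical
import Literature.AnabelianGeometry.AbsoluteAnabelian.AbsTopII.EllipticCuspidalizationContentSchemaScope
import HarnessLib

/-!
# [AbsTopII] Cor 3.3 (iii‴) / Cor 3.4′ over the datum: the pinned chain refines the unpinned one, and
# two canonical outputs for the same data are isomorphic over `Π`

S. Mochizuki, *Topics in Absolute Anabelian Geometry II* [AbsTopII] (bib `MochizukiAbsTopII2013`;
kurims manuscript `paper:url-585b8d0ad0d9`, render p0066–p0070), Ex 3.2 pp. 66–67, Cor 3.3 (iii)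
pp. 68–69, Cor 3.4 pp. 69–70.

PROOF-ONLY companion (no definition, no instance, no structure) of
`AbsTopII/EllipticCuspidalizationCanonical.lean` (abc-iut cell, row «COR34-DATUM» steps (S2)–(S5);
seat abc-iut-L4-t4 gen 7):

* `EllipticCuspidalization.RealizesChainPinned.realizesChain` — forgetting the pin gives abc-iut-L4-t6's
  `RealizesChain` (p433376);
* `EllipticDatumModel.IsCanonicalOutput.matches` / `.realizesChain` — a canonical output matches its
  setting and realizes a chain; hence `EllipticDatumModel.cor_3_3_iii''_of_cor_3_3_iii'''`
  (iii‴ ⇒ iii″; with abc-iut-L4-t6's `cor_3_3_iii′_of_cor_3_3_iii″` also ⇒ iii′);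
* `EllipticDatumModel.Cor_3_4'.outputs_iso` — **the content implicit in print's "the natural surjection
  `Π_{U_X} ↠ Π` may be constructed"**: `Cor_3_4′` at `X₁ = X₂`, `s₁ = s₂`, `φ = id` says that two
  CANONICAL outputs of the Cor 3.3 (iii) algorithm for the same member, core and setting have
  cuspidalizations `Π_{U_X} ↠ Π` isomorphic OVER `Π`, uniquely up to `Ker(Π_{U_X} ↠ Π)`-inner
  automorphisms (the hypotheses of Cor 3.4 — common `Σ`-integer `N`, common `l` — hold trivially for
  one member);
* HYGIENE (the content conjunct consumes recorded cusps, after abc-iut-f-064's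
  `EllipticCuspidalization.RealizesChain.nonempty_cusp_of_two_le`, p437333): a canonical output records a
  cusp on `D` (`IsCanonicalOutput.nonempty_cusp_cover`) and, for `N ≥ 2`, forces a recorded cusp on `X`
  (`IsCanonicalOutput.nonempty_cusp_of_two_le`); hence at a member with NO recorded cusp, a datum core and
  settings of level `N ≥ 2` below every open `G₀`, `Cor_3_3_iii″` and `Cor_3_3_iii‴` FAIL
  (`not_cor_3_3_iii''_of_isEmpty_cusp`, `not_cor_3_3_iii'''_of_isEmpty_cusp`) — the generic half of the
  model-level separation certificate («COR33iii″-SEPARATION»; the junk instance is the other half).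

**v2 (finding F-L4t6g7-1: the ω-clause of `RealizesChainPinned` is unsatisfiable at genuine data; repaired
by the intrinsic pin `RealizesChainPinned′` / `IsCanonicalOutput′` / `Cor_3_3_iii⁗` / `Cor_3_4″` of the
statements file v2): the same companion facts for the PRIMED decls — `RealizesChainPinned'.realizesChain`,
`IsCanonicalOutput'.matches/.realizesChain/.N_eq/.nonempty_cusp_of_two_le`,
`cor_3_3_iii''_of_cor_3_3_iii''''`, `Cor_3_4''.outputs_iso`, `not_cor_3_3_iii''''_of_isEmpty_cusp`.**

HONEST FRAMING: statements about OUR typed interface; typed ≠ proved for anything in print; nothing here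
bears on [IUTchIII] Cor 3.12.
-/

noncomputable section

open CategoryTheory Topology
open scoped Pointwise

universe u

namespace Literature.AnabelianGeometry.AbsoluteAnabelian.AbsTopII

open Literature.AlgebraicGeometry.Frobenioids (IsSlimGroup)
open Literature.AnabelianGeometry.Anabelioids (IsSigmaInteger)
open FundamentalExtension
open AbsTopI (ConstructionDataClass)

/-! ### (S2) ⇒ abc-iut-L4-t6's `RealizesChain` -/

namespace EllipticCuspidalization

variable {E : FundamentalExtension.{u}} {K : EllipticCuspidalization E} {S : Set ℕ}
  {CD : CuspidalData E} {hP : IsSlimGroup E.arith} {hΔ : IsSlimGroup E.geom} {hne : E.geom ≠ ⊥}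
  {H : Subgroup K.core.arith}

/-- Forgetting the pin of the ⋏-step: a pinned realized chain is a realized chain in abc-iut-L4-t6's
sense (`RealizesChain`, p433376). [cite: MochizukiAbsTopII2013, Cor 3.3 (iii)(a) p.68] -/
theorem RealizesChainPinned.realizesChain (h : K.RealizesChainPinned S CD hP hΔ hne H) :
    K.RealizesChain S CD hP hΔ hne := by
  obtain ⟨c, hσ, htype, hterm, s, t, v, hst, htv, hv, eU, eD, eV, gU, gD, gV, ψ, hU, hD, hV, hψs,
    htail, hlast, -⟩ := h
  exact ⟨c, hσ, htype, hterm, s, t, v, hst, htv, hv, eU, eD, eV, gU, gD, gV, ψ, hU, hD, hV, hψs,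
    htail, hlast⟩

end EllipticCuspidalization

/-! ### (S3)/(S5): canonical outputs match and realize; iii‴ ⇒ iii″ -/

namespace EllipticDatumModel

variable {𝒟 : ConstructionDataClass.{u}} {M : EllipticDatumModel 𝒟}

/-- A canonical output matches its setting. [cite: MochizukiAbsTopII2013, Cor 3.3 (iii) pp.68-69] -/
theorem IsCanonicalOutput.matches {b : 𝒟.Base} {X : (𝒟.datum b).Obj} {h : M.IsCor33Member b X}
    {C : (𝒟.datum b).Obj} {f : (𝒟.datum b).Hom X C} {s : M.Setting b X C f}
    {K : EllipticCuspidalization ((𝒟.datum b).ext X)} (hK : M.IsCanonicalOutput h s K) :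
    M.Matches s K :=
  hK.1

/-- A canonical output realizes a chain (abc-iut-L4-t6's `RealizesChain`).
[cite: MochizukiAbsTopII2013, Cor 3.3 (iii)(a) p.68] -/
theorem IsCanonicalOutput.realizesChain {b : 𝒟.Base} {X : (𝒟.datum b).Obj} {h : M.IsCor33Member b X}
    {C : (𝒟.datum b).Obj} {f : (𝒟.datum b).Hom X C} {s : M.Setting b X C f}
    {K : EllipticCuspidalization ((𝒟.datum b).ext X)} (hK : M.IsCanonicalOutput h s K) :
    K.RealizesChain (𝒟.datum b).primes (M.cusps b X)
      (((𝒟.datum b).ext X).arith_slim_of_geom_slim_of_gal_slim h.geom_slim h.slim)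
      h.geom_slim h.geom_ne_bot := by
  obtain ⟨-, e, x, -, -, hpin⟩ := hK
  exact hpin.realizesChain

/-- **Cor 3.3 (iii‴) ⇒ Cor 3.3 (iii″)**: a canonical output is in particular an output matching the
setting and realizing a chain. [cite: MochizukiAbsTopII2013, Cor 3.3 (iii) pp.68-69] -/
theorem cor_3_3_iii''_of_cor_3_3_iii''' (h3 : M.Cor_3_3_iii''') : M.Cor_3_3_iii'' := by
  intro hfull hGC b X h C f hf hC N
  obtain ⟨G₀, hG₀, hs⟩ := h3 hfull hGC b X h C f hf hC N
  refine ⟨G₀, hG₀, fun s hN hle => ?_⟩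
  obtain ⟨K, hK⟩ := hs s hN hle
  exact ⟨K, hK.matches, hK.realizesChain⟩

/-! ### (S4) at one member: canonical outputs are isomorphic over `Π` -/

/-- **Two CANONICAL outputs of the Cor 3.3 (iii) algorithm for the same member, datum core and setting
have cuspidalizations `Π_{U_X} ↠ Π` isomorphic over `Π`, uniquely up to `Ker(Π_{U_X} ↠ Π)`-inner
automorphisms** — `Cor_3_4′` at `X₁ = X₂ = X`, `s₁ = s₂ = s`, `φ = id` (the hypotheses "`N` a
`Σ₁ ∩ Σ₂`-integer" and "a common `l` with `χ_l` open" hold by the setting's `level_isSigmaInteger` and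
the member's cyclotomic hypothesis).  This is the well-definedness implicit in print's "the natural
surjection `Π_{U_X} ↠ Π` — i.e., 'cuspidalization' of `Π` — may be constructed".
[cite: MochizukiAbsTopII2013, Cor 3.4 pp.69-70] -/
theorem Cor_3_4'.outputs_iso (h34 : M.Cor_3_4') (hfull : 𝒟.IsChainFull) (hGC : 𝒟.RelIsomDGC)
    {b : 𝒟.Base} {X : (𝒟.datum b).Obj} (h : M.IsCor33Member b X) {C : (𝒟.datum b).Obj}
    {f : (𝒟.datum b).Hom X C} (hf : M.IsFinEt f) (hC : M.IsCoreOf b C X) (s : M.Setting b X C f)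
    {K K' : EllipticCuspidalization ((𝒟.datum b).ext X)} (hK : M.IsCanonicalOutput h s K)
    (hK' : M.IsCanonicalOutput h s K') :
    (∃ φU : K.cuspUX.arith ≃ₜ* K'.cuspUX.arith, ∀ x, K'.proj.arith (φU x) = K.proj.arith x) ∧
      ∀ φU φU' : K.cuspUX.arith ≃ₜ* K'.cuspUX.arith,
        (∀ x, K'.proj.arith (φU x) = K.proj.arith x) →
        (∀ x, K'.proj.arith (φU' x) = K.proj.arith x) →
          ∃ g : K'.cuspUX.arith, K'.proj.arith g = 1 ∧ ∀ x, φU' x = g * φU x * g⁻¹ := by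
  have hN : IsSigmaInteger ((𝒟.datum b).primes ∩ (𝒟.datum b).primes) s.level := by
    rw [Set.inter_self]
    exact s.level_isSigmaInteger
  obtain ⟨l, hl, hlS, hχ⟩ := h.cyclotomic
  have hmap : ((𝒟.datum b).ext X).geom.map
      (ContinuousMulEquiv.refl ((𝒟.datum b).ext X).arith).toMonoidHom = ((𝒟.datum b).ext X).geom := by
    ext y
    simp only [Subgroup.mem_map]
    constructor
    · rintro ⟨z, hz, rfl⟩
      exact hz
    · intro hy
      exact ⟨y, hy, rfl⟩
  have h := h34 hfull hGC b b X X h h C C f f hf hC hf hC s s rfl hN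
    ⟨l, hl, hlS, hlS, hχ, hχ⟩ K K' hK hK' (ContinuousMulEquiv.refl _) hmap
  exact h

/-! ### Hygiene: canonical outputs and the content conjunct consume recorded cusps -/

/-- A canonical output records a cusp on the once-punctured elliptic curve `D` of its setting (the pin is
read at a cusp `x` of `D`). [cite: MochizukiAbsTopII2013, Cor 3.3 (iii)(a) p.68] -/
theorem IsCanonicalOutput.nonempty_cusp_cover {b : 𝒟.Base} {X : (𝒟.datum b).Obj}
    {h : M.IsCor33Member b X} {C : (𝒟.datum b).Obj} {f : (𝒟.datum b).Hom X C} {s : M.Setting b X C f}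
    {K : EllipticCuspidalization ((𝒟.datum b).ext X)} (hK : M.IsCanonicalOutput h s K) :
    Nonempty (M.cusps b s.D).Cusp := by
  obtain ⟨-, -, x, -⟩ := hK
  exact ⟨x⟩

/-- A canonical output has the level of its setting: `K.N = N`. [cite: MochizukiAbsTopII2013, Cor 3.3 (iii) p.68] -/
theorem IsCanonicalOutput.N_eq {b : 𝒟.Base} {X : (𝒟.datum b).Obj} {h : M.IsCor33Member b X}
    {C : (𝒟.datum b).Obj} {f : (𝒟.datum b).Hom X C} {s : M.Setting b X C f}
    {K : EllipticCuspidalization ((𝒟.datum b).ext X)} (hK : M.IsCanonicalOutput h s K) :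
    K.N = s.level :=
  hK.matches.1

/-- **For `N ≥ 2` a canonical output forces a recorded cusp on `X`** (abc-iut-f-064's
`RealizesChain.nonempty_cusp_of_two_le`: the `N² − 1 ≥ 3` de-cuspidalizations kill cuspidal decomposition
groups coming from cusps OF `X`). [cite: MochizukiAbsTopII2013, Cor 3.3 (iii)(a) p.68] -/
theorem IsCanonicalOutput.nonempty_cusp_of_two_le {b : 𝒟.Base} {X : (𝒟.datum b).Obj}
    {h : M.IsCor33Member b X} {C : (𝒟.datum b).Obj} {f : (𝒟.datum b).Hom X C} {s : M.Setting b X C f}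
    {K : EllipticCuspidalization ((𝒟.datum b).ext X)} (hK : M.IsCanonicalOutput h s K)
    (h2 : 2 ≤ s.level) : Nonempty (M.cusps b X).Cusp :=
  hK.realizesChain.nonempty_cusp_of_two_le (by rw [hK.N_eq]; exact h2)

/-- **`Cor_3_3_iii″` FAILS at a member with no recorded cusp** that has a datum core and settings of a
level `N ≥ 2` below every open `G₀ ⊆ G`: the content conjunct `RealizesChain` consumes the cusp of `X`
(generic half of the model-level separation of iii″ from iii′; abc-iut-f-064's
`not_realizesChain_of_isEmpty_of_two_le`). [cite: MochizukiAbsTopII2013, Cor 3.3 (iii)(a) p.68] -/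
theorem not_cor_3_3_iii''_of_isEmpty_cusp (hfull : 𝒟.IsChainFull) (hGC : 𝒟.RelIsomDGC)
    {b : 𝒟.Base} {X : (𝒟.datum b).Obj} (h : M.IsCor33Member b X) {C : (𝒟.datum b).Obj}
    {f : (𝒟.datum b).Hom X C} (hf : M.IsFinEt f) (hC : M.IsCoreOf b C X) {N : ℕ} (h2 : 2 ≤ N)
    (hs : ∀ G₀ : Subgroup ((𝒟.datum b).ext X).gal, IsOpen (G₀ : Set ((𝒟.datum b).ext X).gal) →
      ∃ s : M.Setting b X C f, s.level = N ∧ s.galOpen ≤ G₀)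
    (hX : IsEmpty (M.cusps b X).Cusp) : ¬ M.Cor_3_3_iii'' := by
  intro h3
  obtain ⟨G₀, hG₀, hout⟩ := h3 hfull hGC b X h C f hf hC N
  obtain ⟨s, hsN, hsle⟩ := hs G₀ hG₀
  obtain ⟨K, hKm, hKr⟩ := hout s hsN hsle
  have hN : 2 ≤ K.N := by rw [hKm.1, hsN]; exact h2
  exact EllipticCuspidalization.not_realizesChain_of_isEmpty_of_two_le hX hN hKr

/-- **`Cor_3_3_iii‴` FAILS at a member with no recorded cusp** (same hypotheses), via iii‴ ⇒ iii″.
[cite: MochizukiAbsTopII2013, Cor 3.3 (iii)(a) p.68] -/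
theorem not_cor_3_3_iii'''_of_isEmpty_cusp (hfull : 𝒟.IsChainFull) (hGC : 𝒟.RelIsomDGC)
    {b : 𝒟.Base} {X : (𝒟.datum b).Obj} (h : M.IsCor33Member b X) {C : (𝒟.datum b).Obj}
    {f : (𝒟.datum b).Hom X C} (hf : M.IsFinEt f) (hC : M.IsCoreOf b C X) {N : ℕ} (h2 : 2 ≤ N)
    (hs : ∀ G₀ : Subgroup ((𝒟.datum b).ext X).gal, IsOpen (G₀ : Set ((𝒟.datum b).ext X).gal) →
      ∃ s : M.Setting b X C f, s.level = N ∧ s.galOpen ≤ G₀)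
    (hX : IsEmpty (M.cusps b X).Cusp) : ¬ M.Cor_3_3_iii''' := fun h3 =>
  not_cor_3_3_iii''_of_isEmpty_cusp hfull hGC h hf hC h2 hs hX (cor_3_3_iii''_of_cor_3_3_iii''' h3)

end EllipticDatumModel

/-! ## v2 (intrinsic pin): the same facts for `RealizesChainPinned′` / `IsCanonicalOutput′` / iii⁗ / 3.4″ -/

namespace EllipticCuspidalization

variable {E : FundamentalExtension.{u}} {K : EllipticCuspidalization E} {S : Set ℕ}
  {CD : CuspidalData E} {hP : IsSlimGroup E.arith} {hΔ : IsSlimGroup E.geom} {hne : E.geom ≠ ⊥}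

/-- Forgetting the intrinsic pin: a pinned realized chain (v2) is a realized chain in abc-iut-L4-t6's
sense. [cite: MochizukiAbsTopII2013, Cor 3.3 (iii)(a) p.68] -/
theorem RealizesChainPinned'.realizesChain (h : K.RealizesChainPinned' S CD hP hΔ hne) :
    K.RealizesChain S CD hP hΔ hne := by
  obtain ⟨c, hσ, htype, hterm, s, t, v, hst, htv, hv, eU, eD, eV, gU, gD, gV, ψ, hU, hD, hV, hψs,
    htail, hlast, -⟩ := h
  exact ⟨c, hσ, htype, hterm, s, t, v, hst, htv, hv, eU, eD, eV, gU, gD, gV, ψ, hU, hD, hV, hψs,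
    htail, hlast⟩

end EllipticCuspidalization

namespace EllipticDatumModel

variable {𝒟 : ConstructionDataClass.{u}} {M : EllipticDatumModel 𝒟}

/-- A canonical output (v2) matches its setting. [cite: MochizukiAbsTopII2013, Cor 3.3 (iii) pp.68-69] -/
theorem IsCanonicalOutput'.matches {b : 𝒟.Base} {X : (𝒟.datum b).Obj} {h : M.IsCor33Member b X}
    {C : (𝒟.datum b).Obj} {f : (𝒟.datum b).Hom X C} {s : M.Setting b X C f}
    {K : EllipticCuspidalization ((𝒟.datum b).ext X)} (hK : M.IsCanonicalOutput' h s K) :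
    M.Matches s K :=
  hK.1

/-- A canonical output (v2) realizes a pinned chain. [cite: MochizukiAbsTopII2013, Cor 3.3 (iii)(a) p.68] -/
theorem IsCanonicalOutput'.realizesChainPinned' {b : 𝒟.Base} {X : (𝒟.datum b).Obj}
    {h : M.IsCor33Member b X} {C : (𝒟.datum b).Obj} {f : (𝒟.datum b).Hom X C} {s : M.Setting b X C f}
    {K : EllipticCuspidalization ((𝒟.datum b).ext X)} (hK : M.IsCanonicalOutput' h s K) :
    K.RealizesChainPinned' (𝒟.datum b).primes (M.cusps b X)
      (((𝒟.datum b).ext X).arith_slim_of_geom_slim_of_gal_slim h.geom_slim h.slim)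
      h.geom_slim h.geom_ne_bot :=
  hK.2

/-- A canonical output (v2) realizes a chain (abc-iut-L4-t6's `RealizesChain`).
[cite: MochizukiAbsTopII2013, Cor 3.3 (iii)(a) p.68] -/
theorem IsCanonicalOutput'.realizesChain {b : 𝒟.Base} {X : (𝒟.datum b).Obj}
    {h : M.IsCor33Member b X} {C : (𝒟.datum b).Obj} {f : (𝒟.datum b).Hom X C} {s : M.Setting b X C f}
    {K : EllipticCuspidalization ((𝒟.datum b).ext X)} (hK : M.IsCanonicalOutput' h s K) :
    K.RealizesChain (𝒟.datum b).primes (M.cusps b X)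
      (((𝒟.datum b).ext X).arith_slim_of_geom_slim_of_gal_slim h.geom_slim h.slim)
      h.geom_slim h.geom_ne_bot :=
  hK.2.realizesChain

/-- A canonical output (v2) has the level of its setting. [cite: MochizukiAbsTopII2013, Cor 3.3 (iii) p.68] -/
theorem IsCanonicalOutput'.N_eq {b : 𝒟.Base} {X : (𝒟.datum b).Obj} {h : M.IsCor33Member b X}
    {C : (𝒟.datum b).Obj} {f : (𝒟.datum b).Hom X C} {s : M.Setting b X C f}
    {K : EllipticCuspidalization ((𝒟.datum b).ext X)} (hK : M.IsCanonicalOutput' h s K) :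
    K.N = s.level :=
  hK.matches.1

/-- For `N ≥ 2` a canonical output (v2) forces a recorded cusp on `X`.
[cite: MochizukiAbsTopII2013, Cor 3.3 (iii)(a) p.68] -/
theorem IsCanonicalOutput'.nonempty_cusp_of_two_le {b : 𝒟.Base} {X : (𝒟.datum b).Obj}
    {h : M.IsCor33Member b X} {C : (𝒟.datum b).Obj} {f : (𝒟.datum b).Hom X C} {s : M.Setting b X C f}
    {K : EllipticCuspidalization ((𝒟.datum b).ext X)} (hK : M.IsCanonicalOutput' h s K)
    (h2 : 2 ≤ s.level) : Nonempty (M.cusps b X).Cusp :=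
  hK.realizesChain.nonempty_cusp_of_two_le (by rw [hK.N_eq]; exact h2)

/-- **Cor 3.3 (iii⁗) ⇒ Cor 3.3 (iii″)** (v2). [cite: MochizukiAbsTopII2013, Cor 3.3 (iii) pp.68-69] -/
theorem cor_3_3_iii''_of_cor_3_3_iii'''' (h3 : M.Cor_3_3_iii'''') : M.Cor_3_3_iii'' := by
  intro hfull hGC b X h C f hf hC N
  obtain ⟨G₀, hG₀, hs⟩ := h3 hfull hGC b X h C f hf hC N
  refine ⟨G₀, hG₀, fun s hN hle => ?_⟩
  obtain ⟨K, hK⟩ := hs s hN hle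
  exact ⟨K, hK.matches, hK.realizesChain⟩

/-- **Two canonical outputs (v2) for the same member, datum core and setting have cuspidalizations
`Π_{U_X} ↠ Π` isomorphic over `Π`, uniquely up to `Ker(Π_{U_X} ↠ Π)`-inner automorphisms** —
`Cor_3_4″` at `X₁ = X₂`, `s₁ = s₂`, `φ = id`. [cite: MochizukiAbsTopII2013, Cor 3.4 pp.69-70] -/
theorem Cor_3_4''.outputs_iso (h34 : M.Cor_3_4'') (hfull : 𝒟.IsChainFull) (hGC : 𝒟.RelIsomDGC)
    {b : 𝒟.Base} {X : (𝒟.datum b).Obj} (h : M.IsCor33Member b X) {C : (𝒟.datum b).Obj}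
    {f : (𝒟.datum b).Hom X C} (hf : M.IsFinEt f) (hC : M.IsCoreOf b C X) (s : M.Setting b X C f)
    {K K' : EllipticCuspidalization ((𝒟.datum b).ext X)} (hK : M.IsCanonicalOutput' h s K)
    (hK' : M.IsCanonicalOutput' h s K') :
    (∃ φU : K.cuspUX.arith ≃ₜ* K'.cuspUX.arith, ∀ x, K'.proj.arith (φU x) = K.proj.arith x) ∧
      ∀ φU φU' : K.cuspUX.arith ≃ₜ* K'.cuspUX.arith,
        (∀ x, K'.proj.arith (φU x) = K.proj.arith x) →
        (∀ x, K'.proj.arith (φU' x) = K.proj.arith x) →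
          ∃ g : K'.cuspUX.arith, K'.proj.arith g = 1 ∧ ∀ x, φU' x = g * φU x * g⁻¹ := by
  have hN : IsSigmaInteger ((𝒟.datum b).primes ∩ (𝒟.datum b).primes) s.level := by
    rw [Set.inter_self]
    exact s.level_isSigmaInteger
  obtain ⟨l, hl, hlS, hχ⟩ := h.cyclotomic
  have hmap : ((𝒟.datum b).ext X).geom.map
      (ContinuousMulEquiv.refl ((𝒟.datum b).ext X).arith).toMonoidHom = ((𝒟.datum b).ext X).geom := by
    ext y
    simp only [Subgroup.mem_map]
    constructor
    · rintro ⟨z, hz, rfl⟩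
      exact hz
    · intro hy
      exact ⟨y, hy, rfl⟩
  exact h34 hfull hGC b b X X h h C C f f hf hC hf hC s s rfl hN
    ⟨l, hl, hlS, hlS, hχ, hχ⟩ K K' hK hK' (ContinuousMulEquiv.refl _) hmap

/-- **`Cor_3_3_iii⁗` FAILS at a member with no recorded cusp** that has a datum core and settings of a
level `N ≥ 2` below every open `G₀ ⊆ G` (v2; via iii⁗ ⇒ iii″).
[cite: MochizukiAbsTopII2013, Cor 3.3 (iii)(a) p.68] -/
theorem not_cor_3_3_iii''''_of_isEmpty_cusp (hfull : 𝒟.IsChainFull) (hGC : 𝒟.RelIsomDGC)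
    {b : 𝒟.Base} {X : (𝒟.datum b).Obj} (h : M.IsCor33Member b X) {C : (𝒟.datum b).Obj}
    {f : (𝒟.datum b).Hom X C} (hf : M.IsFinEt f) (hC : M.IsCoreOf b C X) {N : ℕ} (h2 : 2 ≤ N)
    (hs : ∀ G₀ : Subgroup ((𝒟.datum b).ext X).gal, IsOpen (G₀ : Set ((𝒟.datum b).ext X).gal) →
      ∃ s : M.Setting b X C f, s.level = N ∧ s.galOpen ≤ G₀)
    (hX : IsEmpty (M.cusps b X).Cusp) : ¬ M.Cor_3_3_iii'''' := fun h3 =>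
  not_cor_3_3_iii''_of_isEmpty_cusp hfull hGC h hf hC h2 hs hX (cor_3_3_iii''_of_cor_3_3_iii'''' h3)

end EllipticDatumModel

end Literature.AnabelianGeometry.AbsoluteAnabelian.AbsTopII

end
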